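import Mathlib
import Summits.RiemannHypothesis.RiemannHypothesis.Theorems.WeilFormatCPathGraphBound
import HarnessLib

/-!
# Format C: the compressed shift on a window — `2|⟨f(· − ℓ), f⟩| ≤ 2cos(π/(N+1))·‖f‖²`

Route context: Fourier–Galerkin / Schur-complement certificates of Weil positivity on a window ("format C";
cell memo `run/shared/lean/pub/rh-explicit/rh-explicit-weil-10/FORMATC-DESIGN.md` §4.3, PRIME part; sibling
`WeilFormatCPathGraphBound.lean` = the finite-dimensional core; supporting stmt-RiemannHypothesis-0098).

The prime part of Weil's functional on test functions supported in `[−a, a]` is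
`−Σ_ℓ Λ_ℓ (F(ℓ) + F(−ℓ))`, `F = f ⋆ f̃`, i.e. `−Σ_ℓ Λ_ℓ · 2⟨f(· − ℓ), f⟩_{L²[−a,a]}` for real `f`.  The naive
bound `|2⟨f(· − ℓ), f⟩| ≤ 2‖f‖²` gives Yoshida's constant `A(μ) = 2 Σ_ℓ Λ_ℓ`; the sharp constant of this file
replaces the `2` by the Perron eigenvalue `2cos(π/(N+1))` of the PATH GRAPH with `N` vertices, for any `N` with
`N·ℓ > 2a` (best: `N = ⌊2a/ℓ⌋ + 1`): fibrewise over `x₀ ∈ [−a, −a+ℓ)` the points `x₀ + jℓ`, `0 ≤ j < N`, exhaust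
the window, and `f(x−ℓ)f(x)` couples neighbours only.

* `WeilFormatC.two_mul_abs_integral_shift_mul_le` — for `f : ℝ → ℝ` measurable, bounded, vanishing off
  `[−a, a]` (any real `a`), `0 < ℓ`, `N ≥ 1` with `2a < N ℓ`:
  **`2 |∫_{−a}^{a} f(x − ℓ) f(x) dx| ≤ 2cos(π/(N+1)) ∫_{−a}^{a} f(x)² dx`.**

Measure theory is Mathlib's interval integral; the window decomposition is
`intervalIntegral.sum_integral_adjacent_intervals` + translation invariance.  Standard axioms only.  NOT here:
the identification of the Fourier-basis Gram entries of the prime term with these inner products (L-C1).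
-/

-- `Summit.RiemannHypothesis.RiemannHypothesis.…` is the layout-mandated namespace (summit = problem name).
set_option linter.dupNamespace false

noncomputable section

open MeasureTheory Set Finset intervalIntegral
open scoped Real

namespace Summit.RiemannHypothesis.RiemannHypothesis.Theorems.WeilFormatC

/-- A bounded measurable real function is interval-integrable on every bounded interval. -/
theorem intervalIntegrable_of_bounded {g : ℝ → ℝ} (hg : Measurable g) {C : ℝ} (hC : ∀ x, |g x| ≤ C)
    (c d : ℝ) : IntervalIntegrable g volume c d := by
  rw [intervalIntegrable_iff]
  have hs : volume (Set.uIoc c d) ≠ ⊤ := by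
    rw [Set.uIoc, Real.volume_Ioc]; exact ENNReal.ofReal_ne_top
  refine Integrable.mono' (integrableOn_const (C := C) hs) hg.aestronglyMeasurable ?_
  exact Filter.Eventually.of_forall fun x ↦ by simpa [Real.norm_eq_abs] using hC x

section Shift

variable {f : ℝ → ℝ} {a ℓ C : ℝ}

/-- Fibre decomposition of the window energy: for `f` vanishing off `[−a, a]` and `a ≤ −a + N ℓ`,
`∫_{−a}^{a} f² = ∫_{−a}^{−a+ℓ} Σ_{j<N} f(x₀ + jℓ)² dx₀`. -/
theorem integral_sq_eq_integral_fibre_sum (hf : Measurable f) (hC : ∀ x, |f x| ≤ C)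
    (hsupp : ∀ x, x ∉ Icc (-a) a → f x = 0) (N : ℕ) (hN : a ≤ -a + N * ℓ) :
    ∫ x in (-a)..a, f x ^ 2 = ∫ x₀ in (-a)..(-a + ℓ), ∑ j ∈ range N, f (x₀ + j * ℓ) ^ 2 := by
  have hb : ∀ x, |f x ^ 2| ≤ C ^ 2 := fun x ↦ by
    rw [abs_pow]; exact pow_le_pow_left₀ (abs_nonneg _) (hC x) 2
  have hmeas2 : Measurable fun x ↦ f x ^ 2 := hf.pow_const 2
  have hii : ∀ c d : ℝ, IntervalIntegrable (fun x ↦ f x ^ 2) volume c d :=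
    intervalIntegrable_of_bounded hmeas2 hb
  -- extend the integral to `[-a, -a + N ℓ]` (the integrand vanishes on `(a, -a + N ℓ]`)
  have hext : ∫ x in (-a)..a, f x ^ 2 = ∫ x in (-a)..(-a + N * ℓ), f x ^ 2 := by
    rw [← integral_add_adjacent_intervals (hii (-a) a) (hii a (-a + N * ℓ))]
    have hz : ∫ x in a..(-a + N * ℓ), f x ^ 2 = 0 := by
      rw [integral_of_le hN]
      refine setIntegral_eq_zero_of_forall_eq_zero fun x hx ↦ ?_
      have : f x = 0 := hsupp x fun h ↦ by linarith [h.2, hx.1]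
      simp [this]
    rw [hz, add_zero]
  rw [hext]
  -- split into the N translates of `[-a, -a + ℓ]`
  have hsplit := sum_integral_adjacent_intervals (f := fun x ↦ f x ^ 2) (μ := volume)
    (a := fun k : ℕ ↦ -a + k * ℓ) (n := N) (fun k _ ↦ hii _ _)
  simp only [Nat.cast_zero, zero_mul, add_zero] at hsplit
  rw [← hsplit, intervalIntegral.integral_finsetSum (fun j _ ↦ ?_)]
  · refine Finset.sum_congr rfl fun j _ ↦ ?_
    rw [intervalIntegral.integral_comp_add_right (fun x ↦ f x ^ 2) ((j : ℝ) * ℓ)]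
    congr 1
    push_cast
    ring
  · -- integrability of each translate
    have hm : Measurable fun x₀ ↦ f (x₀ + j * ℓ) ^ 2 := (hf.comp (measurable_id.add_const _)).pow_const 2
    exact intervalIntegrable_of_bounded hm (fun x ↦ hb _) _ _

/-- Fibre decomposition of the shifted inner product: under the same hypotheses,
`∫_{−a}^{a} f(x−ℓ) f(x) dx = ∫_{−a}^{−a+ℓ} Σ_{j<N} f(x₀ + jℓ − ℓ) f(x₀ + jℓ) dx₀`. -/
theorem integral_shift_mul_eq_integral_fibre_sum (hf : Measurable f) (hC : ∀ x, |f x| ≤ C)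
    (hsupp : ∀ x, x ∉ Icc (-a) a → f x = 0) (N : ℕ) (hN : a ≤ -a + N * ℓ) :
    ∫ x in (-a)..a, f (x - ℓ) * f x
      = ∫ x₀ in (-a)..(-a + ℓ), ∑ j ∈ range N, f (x₀ + j * ℓ - ℓ) * f (x₀ + j * ℓ) := by
  have hC0 : 0 ≤ C := le_trans (abs_nonneg _) (hC 0)
  have hb : ∀ x, |f (x - ℓ) * f x| ≤ C * C := fun x ↦ by
    rw [abs_mul]; exact mul_le_mul (hC _) (hC _) (abs_nonneg _) hC0
  have hmeas2 : Measurable fun x ↦ f (x - ℓ) * f x := (hf.comp (measurable_id.sub_const _)).mul hf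
  have hii : ∀ c d : ℝ, IntervalIntegrable (fun x ↦ f (x - ℓ) * f x) volume c d :=
    intervalIntegrable_of_bounded hmeas2 hb
  have hext : ∫ x in (-a)..a, f (x - ℓ) * f x = ∫ x in (-a)..(-a + N * ℓ), f (x - ℓ) * f x := by
    rw [← integral_add_adjacent_intervals (hii (-a) a) (hii a (-a + N * ℓ))]
    have hz : ∫ x in a..(-a + N * ℓ), f (x - ℓ) * f x = 0 := by
      rw [integral_of_le hN]
      refine setIntegral_eq_zero_of_forall_eq_zero fun x hx ↦ ?_
      have : f x = 0 := hsupp x fun h ↦ by linarith [h.2, hx.1]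
      simp [this]
    rw [hz, add_zero]
  rw [hext]
  have hsplit := sum_integral_adjacent_intervals (f := fun x ↦ f (x - ℓ) * f x) (μ := volume)
    (a := fun k : ℕ ↦ -a + k * ℓ) (n := N) (fun k _ ↦ hii _ _)
  simp only [Nat.cast_zero, zero_mul, add_zero] at hsplit
  rw [← hsplit, intervalIntegral.integral_finsetSum (fun j _ ↦ ?_)]
  · refine Finset.sum_congr rfl fun j _ ↦ ?_
    rw [intervalIntegral.integral_comp_add_right (fun x ↦ f (x - ℓ) * f x) ((j : ℝ) * ℓ)]
    congr 1
    push_cast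
    ring
  · have hm : Measurable fun x₀ ↦ f (x₀ + j * ℓ - ℓ) * f (x₀ + j * ℓ) :=
      (hf.comp ((measurable_id.add_const _).sub_const _)).mul (hf.comp (measurable_id.add_const _))
    exact intervalIntegrable_of_bounded hm (fun x ↦ by
      rw [abs_mul]; exact mul_le_mul (hC _) (hC _) (abs_nonneg _) hC0) _ _

/-- The pointwise (fibre) inequality: for `x₀ ∈ (−a, −a+ℓ)` the `j = 0` cross term vanishes
(`x₀ − ℓ < −a`), the remaining ones form the path graph on the `N` values `f(x₀ + jℓ)`, `j < N`, and
`WeilFormatC.pathGraph_two_mul_abs_sum_le` applies. -/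
theorem fibre_two_mul_abs_sum_le (hsupp : ∀ x, x ∉ Icc (-a) a → f x = 0) {N : ℕ} (hN1 : 1 ≤ N)
    {x₀ : ℝ} (hx₀ : x₀ ∈ Ioo (-a) (-a + ℓ)) :
    2 * |∑ j ∈ range N, f (x₀ + j * ℓ - ℓ) * f (x₀ + j * ℓ)|
      ≤ 2 * Real.cos (π / (N + 1)) * ∑ j ∈ range N, f (x₀ + j * ℓ) ^ 2 := by
  obtain ⟨n, rfl⟩ : ∃ n, N = n + 1 := ⟨N - 1, by omega⟩
  -- the path-graph lemma with `x (k) = f (x₀ + (k - 1) ℓ)`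
  set xs : ℕ → ℝ := fun k ↦ f (x₀ + ((k : ℝ) - 1) * ℓ) with hxs
  have hpg := pathGraph_two_mul_abs_sum_le n xs
  -- identify the energy
  have hE : ∑ i ∈ range (n + 1), xs (i + 1) ^ 2 = ∑ j ∈ range (n + 1), f (x₀ + j * ℓ) ^ 2 := by
    refine Finset.sum_congr rfl fun i _ ↦ ?_
    simp only [hxs]; push_cast; ring_nf
  -- identify the cross term: drop the vanishing `j = 0` summand, then shift
  have h0 : f (x₀ + (0 : ℕ) * ℓ - ℓ) * f (x₀ + (0 : ℕ) * ℓ) = 0 := by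
    have : f (x₀ - ℓ) = 0 := hsupp _ fun h ↦ by linarith [h.1, hx₀.2]
    simp [this]
  have hX : ∑ j ∈ range (n + 1), f (x₀ + j * ℓ - ℓ) * f (x₀ + j * ℓ)
      = ∑ i ∈ range n, xs (i + 1) * xs (i + 2) := by
    rw [Finset.sum_range_succ', h0, add_zero]
    refine Finset.sum_congr rfl fun i _ ↦ ?_
    simp only [hxs]; push_cast; ring_nf
  have hcos : Real.cos (π / ((n : ℝ) + 2)) = Real.cos (π / ((n + 1 : ℕ) + 1)) := by
    push_cast; ring_nf
  rw [hX, ← hE, ← hcos]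
  exact hpg

/-- **The compressed shift on a window.**  For `f : ℝ → ℝ` measurable and bounded, vanishing outside
`[−a, a]`, a shift `ℓ > 0` and any `N ≥ 1` with `2a < N ℓ`:
`2 |∫_{−a}^{a} f(x−ℓ) f(x) dx| ≤ 2cos(π/(N+1)) · ∫_{−a}^{a} f(x)² dx`.
With `N = ⌊2a/ℓ⌋ + 1` and summed over the prime powers `ℓ = e log p < 2a` with weights
`Λ_ℓ = log p · p^{−e/2}` this is the bound `PRIME ⪰ −A_op⁺` of the far-coercivity lemma
(FORMATC-DESIGN §4.3), `A_op⁺ = Σ_ℓ Λ_ℓ · 2cos(π/(⌊2a/ℓ⌋ + 2))`. -/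
theorem two_mul_abs_integral_shift_mul_le (hf : Measurable f) (hC : ∀ x, |f x| ≤ C)
    (hsupp : ∀ x, x ∉ Icc (-a) a → f x = 0) (hℓ : 0 < ℓ) {N : ℕ} (hN1 : 1 ≤ N)
    (hN : 2 * a < N * ℓ) :
    2 * |∫ x in (-a)..a, f (x - ℓ) * f x|
      ≤ 2 * Real.cos (π / (N + 1)) * ∫ x in (-a)..a, f x ^ 2 := by
  have hN' : a ≤ -a + N * ℓ := by linarith
  have hC0 : 0 ≤ C := le_trans (abs_nonneg _) (hC 0)
  rw [integral_shift_mul_eq_integral_fibre_sum hf hC hsupp N hN',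
    integral_sq_eq_integral_fibre_sum hf hC hsupp N hN']
  set X : ℝ → ℝ := fun x₀ ↦ ∑ j ∈ range N, f (x₀ + j * ℓ - ℓ) * f (x₀ + j * ℓ) with hX
  set E : ℝ → ℝ := fun x₀ ↦ ∑ j ∈ range N, f (x₀ + j * ℓ) ^ 2 with hE
  have hle : -a ≤ -a + ℓ := by linarith
  -- integrability of the fibre sums (finite sums of bounded measurable functions)
  have hXm : Measurable X := by
    refine Finset.measurable_sum _ fun j _ ↦ ?_
    exact (hf.comp ((measurable_id.add_const _).sub_const _)).mul (hf.comp (measurable_id.add_const _))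
  have hEm : Measurable E := by
    refine Finset.measurable_sum _ fun j _ ↦ ?_
    exact (hf.comp (measurable_id.add_const _)).pow_const 2
  have hXb : ∀ x₀, |X x₀| ≤ N * (C * C) := fun x₀ ↦ by
    refine (Finset.abs_sum_le_sum_abs _ _).trans ?_
    calc ∑ j ∈ range N, |f (x₀ + j * ℓ - ℓ) * f (x₀ + j * ℓ)|
        ≤ ∑ j ∈ range N, C * C := Finset.sum_le_sum fun j _ ↦ by
          rw [abs_mul]; exact mul_le_mul (hC _) (hC _) (abs_nonneg _) hC0
      _ = N * (C * C) := by simp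
  have hEb : ∀ x₀, |E x₀| ≤ N * C ^ 2 := fun x₀ ↦ by
    refine (Finset.abs_sum_le_sum_abs _ _).trans ?_
    calc ∑ j ∈ range N, |f (x₀ + j * ℓ) ^ 2|
        ≤ ∑ j ∈ range N, C ^ 2 := Finset.sum_le_sum fun j _ ↦ by
          rw [abs_pow]; exact pow_le_pow_left₀ (abs_nonneg _) (hC _) 2
      _ = N * C ^ 2 := by simp
  have hXi : IntervalIntegrable X volume (-a) (-a + ℓ) := intervalIntegrable_of_bounded hXm hXb _ _
  have hEi : IntervalIntegrable E volume (-a) (-a + ℓ) := intervalIntegrable_of_bounded hEm hEb _ _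
  have habsXi : IntervalIntegrable (fun x₀ ↦ 2 * |X x₀|) volume (-a) (-a + ℓ) :=
    (hXi.abs).const_mul 2
  -- `2|∫ X| ≤ ∫ 2|X| ≤ ∫ 2cos·E = 2cos ∫ E`
  calc 2 * |∫ x₀ in (-a)..(-a + ℓ), X x₀|
      ≤ 2 * ∫ x₀ in (-a)..(-a + ℓ), |X x₀| := by
        gcongr; exact abs_integral_le_integral_abs hle
    _ = ∫ x₀ in (-a)..(-a + ℓ), 2 * |X x₀| := by
        rw [intervalIntegral.integral_const_mul]
    _ ≤ ∫ x₀ in (-a)..(-a + ℓ), 2 * Real.cos (π / (N + 1)) * E x₀ := by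
        refine integral_mono_on_of_le_Ioo hle habsXi (hEi.const_mul _) fun x₀ hx₀ ↦ ?_
        exact fibre_two_mul_abs_sum_le hsupp hN1 hx₀
    _ = 2 * Real.cos (π / (N + 1)) * ∫ x₀ in (-a)..(-a + ℓ), E x₀ := by
        rw [intervalIntegral.integral_const_mul]

end Shift

end Summit.RiemannHypothesis.RiemannHypothesis.Theorems.WeilFormatC
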